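import Mathlib
import Literature.NumberTheory.LFunctions.LogRieszWeights

/-!
# Crux `SignCone.ConeMagnification` (stmt-RiemannHypothesis-16303), line `Sketch` r9, stub `stub_combType` — assembly, part 1:
# the deep-zone class identity and the harmonic cut-off weights

Pure arithmetic/limit bookkeeping for the assembly of `stub_combType` (seat-0 holds the assembly; the c-free sharp node
evaluation is the lead's wave 3).  In the node form of the `ζ`-mollified comb the deep-zone main term at the node `n` for the pair
`(ℓ, ℓ')` is `B(0)√(ℓ/ℓ')·(Σ_{k' ≤ K} [ℓ ∣ nℓ'k']/k')/n` with `K = ⌊X/(nℓ')⌋`, `X = M/(4κ)`: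

* `sum_dvd_indicator_div_eq_harmonic` — `Σ_{k' ≤ K} [ℓ ∣ nℓ'k']/k' = (1/q)·H(K/q)`, `q = ℓ/gcd(nℓ',ℓ)` (the condition is `q ∣ k'`);
  so on the gcd class `gcd(nℓ',ℓ) = δ` the deep term is `B(0)(δ/√(ℓℓ'))·H(⌊X/(nℓ')⌋/(ℓ/δ))/n`;
* the harmonic cut-off weight `H(⌊X/((max n 1)ℓ')⌋/q)` (written out, no definition) and its regularity as a cut-off family along
  `X_M = M/(4√(log M))`, normalised by `log M`: antitone in `n`, nonnegative, `= 0` for `nℓ' > X`, and `→ 1` for each fixed `n`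
  (`harmWeight_antitone`, `harmWeight_nonneg`, `harmWeight_eq_zero`, `tendsto_harmWeight_div_log`) — the hypotheses of the referee's
  `TypeDesign.tendsto_sum_mul_weight_of_tendsto`.
-/

noncomputable section

-- `Summit.RiemannHypothesis.RiemannHypothesis.…` repeats a namespace component by design (D-0017 layout).
set_option linter.dupNamespace false

open scoped BigOperators Topology
open Set Filter

namespace Summit.RiemannHypothesis.RiemannHypothesis.Theorems.SignConeConeMagnification

namespace CombType

/-! ### Real harmonic numbers over `[1, J]` -/

/-- `H(J) = Σ_{j ∈ [1,J]} 1/j` equals Mathlib's `harmonic J`. [folklore] -/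
theorem sum_Icc_one_div_eq_harmonic (J : ℕ) : ∑ j ∈ Finset.Icc 1 J, (1 : ℝ) / j = (harmonic J : ℝ) := by
  rw [harmonic_eq_sum_Icc]
  push_cast
  exact Finset.sum_congr rfl fun j _ => by rw [one_div]

/-- `0 ≤ H(J)`. [folklore] -/
theorem harmonicR_nonneg (J : ℕ) : 0 ≤ ∑ j ∈ Finset.Icc 1 J, (1 : ℝ) / j :=
  Finset.sum_nonneg fun j _ => by positivity

/-- `H` is monotone. [folklore] -/
theorem harmonicR_mono {J J' : ℕ} (h : J ≤ J') :
    ∑ j ∈ Finset.Icc 1 J, (1 : ℝ) / j ≤ ∑ j ∈ Finset.Icc 1 J', (1 : ℝ) / j :=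
  Finset.sum_le_sum_of_subset_of_nonneg (Finset.Icc_subset_Icc_right h) fun j _ _ => by positivity

/-- `log(J+1) ≤ H(J)` (Mathlib's `log_add_one_le_harmonic`). [folklore] -/
theorem log_succ_le_harmonicR (J : ℕ) : Real.log (J + 1) ≤ ∑ j ∈ Finset.Icc 1 J, (1 : ℝ) / j := by
  rw [sum_Icc_one_div_eq_harmonic]
  exact_mod_cast log_add_one_le_harmonic J

/-! ### The deep-zone class identity -/

/-- `ℓ ∣ (nℓ')k' ↔ q ∣ k'` with `q = ℓ / gcd(nℓ', ℓ)` (`ℓ ≠ 0`). [folklore] -/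
theorem dvd_mul_mul_iff (ℓ n ℓ' k' : ℕ) (hℓ : ℓ ≠ 0) :
    ℓ ∣ n * ℓ' * k' ↔ ℓ / Nat.gcd (n * ℓ') ℓ ∣ k' := by
  rw [Nat.gcd_comm, mul_comm (n * ℓ') k']
  -- `ℓ ∣ k' * m ↔ ℓ / gcd ℓ m ∣ k'`
  set m := n * ℓ'
  set g := Nat.gcd ℓ m with hg
  have hg0 : 0 < g := Nat.gcd_pos_of_pos_left _ (Nat.pos_of_ne_zero hℓ)
  obtain ⟨d', hd'⟩ : g ∣ ℓ := Nat.gcd_dvd_left ℓ m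
  obtain ⟨m', hm'⟩ : g ∣ m := Nat.gcd_dvd_right ℓ m
  have hcop : Nat.Coprime d' m' := by
    have h := Nat.coprime_div_gcd_div_gcd (m := ℓ) (n := m) hg0
    rw [← hg] at h
    have e1 : ℓ / g = d' := by rw [hd', Nat.mul_div_cancel_left _ hg0]
    have e2 : m / g = m' := by rw [hm', Nat.mul_div_cancel_left _ hg0]
    rwa [e1, e2] at h
  have e1 : ℓ / g = d' := by rw [hd', Nat.mul_div_cancel_left _ hg0]
  rw [e1]
  constructor
  · intro h
    rw [hd', hm'] at h
    have h' : d' ∣ k' * m' := by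
      have : g * d' ∣ g * (k' * m') := by
        have e : k' * (g * m') = g * (k' * m') := by ring
        rwa [e] at h
      exact (Nat.mul_dvd_mul_iff_left hg0).1 this
    exact hcop.dvd_of_dvd_mul_right h'
  · intro h
    rw [hd']
    calc g * d' ∣ g * k' := Nat.mul_dvd_mul_left g h
      _ ∣ k' * m := by
        rw [hm']
        exact ⟨m', by ring⟩

/-- **The deep-zone class identity**: `Σ_{k' ∈ [1,K]} [ℓ ∣ nℓ'k']/k' = Σ_{j ∈ [1, K/q]} 1/(q j)`, `q = ℓ/gcd(nℓ',ℓ)` (`ℓ ≠ 0`):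
the condition is `q ∣ k'`, write `k' = q j`. [folklore] -/
theorem sum_dvd_indicator_div_eq (ℓ n ℓ' K : ℕ) (hℓ : ℓ ≠ 0) :
    ∑ k' ∈ Finset.Icc 1 K, (if ℓ ∣ n * ℓ' * k' then (1 : ℝ) / k' else 0) =
      ∑ j ∈ Finset.Icc 1 (K / (ℓ / Nat.gcd (n * ℓ') ℓ)), (1 : ℝ) / ((ℓ / Nat.gcd (n * ℓ') ℓ : ℕ) * j) := by
  set q : ℕ := ℓ / Nat.gcd (n * ℓ') ℓ with hq
  have hq0 : 0 < q := by
    rw [hq]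
    exact Nat.div_pos (Nat.le_of_dvd (Nat.pos_of_ne_zero hℓ) (Nat.gcd_dvd_right _ _))
      (Nat.gcd_pos_of_pos_right _ (Nat.pos_of_ne_zero hℓ))
  -- rewrite the condition
  have hcond : ∀ k', (ℓ ∣ n * ℓ' * k' ↔ q ∣ k') := fun k' => dvd_mul_mul_iff ℓ n ℓ' k' hℓ
  rw [Finset.sum_congr rfl fun k' _ => by rw [if_congr (hcond k') rfl rfl], ← Finset.sum_filter]
  -- the filtered set is the image of `[1, K/q]` under `j ↦ q j`
  have himage : (Finset.Icc 1 K).filter (fun k' => q ∣ k') = (Finset.Icc 1 (K / q)).image (fun j => q * j) := by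
    ext k'
    simp only [Finset.mem_filter, Finset.mem_Icc, Finset.mem_image]
    constructor
    · rintro ⟨⟨h1, h2⟩, ⟨j, rfl⟩⟩
      refine ⟨j, ⟨?_, ?_⟩, rfl⟩
      · rcases Nat.eq_zero_or_pos j with rfl | hj
        · simp at h1
        · exact hj
      · exact (Nat.le_div_iff_mul_le hq0).2 (by rw [mul_comm]; exact h2)
    · rintro ⟨j, ⟨h1, h2⟩, rfl⟩
      refine ⟨⟨Nat.mul_pos hq0 h1, ?_⟩, dvd_mul_right q j⟩
      have := (Nat.le_div_iff_mul_le hq0).1 h2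
      rw [mul_comm] at this
      exact this
  rw [himage, Finset.sum_image (fun j _ j' _ h => Nat.eq_of_mul_eq_mul_left hq0 h)]
  refine Finset.sum_congr rfl fun j _ => ?_
  push_cast
  ring

/-- The class harmonic sum scaled: `Σ_{j ≤ J} 1/(q j) = (1/q)·H(J)`. [folklore] -/
theorem sum_one_div_mul_eq (q J : ℕ) :
    ∑ j ∈ Finset.Icc 1 J, (1 : ℝ) / ((q : ℝ) * j) = (1 / (q : ℝ)) * ∑ j ∈ Finset.Icc 1 J, (1 : ℝ) / j := by
  rw [Finset.mul_sum]
  refine Finset.sum_congr rfl fun j _ => ?_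
  rw [one_div_mul_one_div]

/-! ### The harmonic cut-off weights and their regularity -/

/-! The harmonic cut-off weight of the class with period `q` for the pair with second index `ℓ'` is
`W(X, n) = H(⌊X/((max n 1)ℓ')⌋/q) = ∑ j ∈ Finset.Icc 1 (⌊X / ((max n 1 : ℕ) * ℓ')⌋₊ / q), 1/j` (written out; the `max` only fixes
the irrelevant value at `n = 0`). -/

/-- The weight is nonnegative. [folklore] -/
theorem harmWeight_nonneg (X : ℝ) (q ℓ' n : ℕ) : 0 ≤ (∑ j ∈ Finset.Icc 1 (⌊X / ((max n 1 : ℕ) * ℓ')⌋₊ / q), (1 : ℝ) / j) := harmonicR_nonneg _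

/-- The weight is antitone in `n` (`X ≥ 0`, `ℓ' ≥ 1`). [folklore] -/
theorem harmWeight_antitone {X : ℝ} (hX : 0 ≤ X) (q : ℕ) {ℓ' : ℕ} (hℓ' : 1 ≤ ℓ') :
    Antitone (fun n : ℕ => ∑ j ∈ Finset.Icc 1 (⌊X / ((max n 1 : ℕ) * ℓ')⌋₊ / q), (1 : ℝ) / j) := by
  intro n m hnm
  simp only []
  refine harmonicR_mono (Nat.div_le_div_right (Nat.floor_le_floor ?_))
  have h1 : (1 : ℝ) ≤ (max n 1 : ℕ) := by exact_mod_cast le_max_right n 1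
  have h2 : ((max n 1 : ℕ) : ℝ) ≤ (max m 1 : ℕ) := by exact_mod_cast max_le_max hnm le_rfl
  have hℓ'R : (1 : ℝ) ≤ ℓ' := by exact_mod_cast hℓ'
  exact div_le_div_of_nonneg_left hX (by positivity) (by nlinarith)

/-- The weight vanishes once `nℓ' > X`. [folklore] -/
theorem harmWeight_eq_zero {X : ℝ} (q ℓ' : ℕ) {n : ℕ} (hn : 1 ≤ n) (hX : X < n * ℓ') :
    (∑ j ∈ Finset.Icc 1 (⌊X / ((max n 1 : ℕ) * ℓ')⌋₊ / q), (1 : ℝ) / j) = 0 := by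
  have hmax : (max n 1 : ℕ) = n := max_eq_left hn
  rw [hmax]
  have hfloor : ⌊X / ((n : ℝ) * ℓ')⌋₊ = 0 := by
    rcases lt_or_ge X 0 with hX0 | hX0
    · exact Nat.floor_of_nonpos (div_nonpos_of_nonpos_of_nonneg hX0.le (by positivity))
    · have hpos : (0 : ℝ) < n * ℓ' := lt_of_le_of_lt hX0 hX
      exact Nat.floor_eq_zero.2 ((div_lt_one hpos).2 hX)
  rw [hfloor, Nat.zero_div]
  simp

/-- For fixed `n ≥ 0`, `q ≥ 1`, `ℓ' ≥ 1`: along `X_M = M/(4√(log M))` the normalised weight tends to `1`: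
`H(⌊X_M/((max n 1)ℓ')⌋/q)/log M → 1` (squeeze between `log(J+1) ≥ log M − log(8r√(log M))` and `1 + log M`). [folklore] -/
theorem tendsto_harmWeight_div_log {q ℓ' : ℕ} (hq : 1 ≤ q) (hℓ' : 1 ≤ ℓ') (n : ℕ) :
    Tendsto (fun M : ℕ => (∑ j ∈ Finset.Icc 1 (⌊(M : ℝ) / (4 * Real.sqrt (Real.log M)) / ((max n 1 : ℕ) * ℓ')⌋₊ / q),
      (1 : ℝ) / j) / Real.log M) atTop (𝓝 1) := by
  -- abbreviations
  set r : ℝ := ((max n 1 : ℕ) : ℝ) * ℓ' * q with hr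
  have hr1 : 1 ≤ r := by
    have h1 : (1 : ℝ) ≤ (max n 1 : ℕ) := by exact_mod_cast le_max_right n 1
    have h2 : (1 : ℝ) ≤ ℓ' := by exact_mod_cast hℓ'
    have h3 : (1 : ℝ) ≤ q := by exact_mod_cast hq
    rw [hr]
    nlinarith [mul_le_mul h1 h2 zero_le_one (by linarith)]
  have hr0 : 0 < r := by linarith
  have hqR : (0 : ℝ) < q := by exact_mod_cast hq
  set F : ℕ → ℕ := fun M => ⌊(M : ℝ) / (4 * Real.sqrt (Real.log M)) / ((max n 1 : ℕ) * ℓ')⌋₊ with hF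
  set J : ℕ → ℕ := fun M => F M / q with hJ
  have hW : ∀ M : ℕ, (∑ j ∈ Finset.Icc 1 (⌊(M : ℝ) / (4 * Real.sqrt (Real.log M)) / ((max n 1 : ℕ) * ℓ')⌋₊ / q),
      (1 : ℝ) / j) = ∑ j ∈ Finset.Icc 1 (J M), (1 : ℝ) / j := fun M => rfl
  -- `J M ≥ Y/r - 2`
  have hJ_lower : ∀ M : ℕ, (M : ℝ) / (4 * Real.sqrt (Real.log M)) / r - 2 ≤ (J M : ℝ) := by
    intro M
    have h1 : (M : ℝ) / (4 * Real.sqrt (Real.log M)) / ((max n 1 : ℕ) * ℓ') - 1 ≤ (F M : ℝ) := by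
      have := Nat.lt_floor_add_one ((M : ℝ) / (4 * Real.sqrt (Real.log M)) / ((max n 1 : ℕ) * ℓ'))
      simp only [hF]
      linarith
    have h2 : (F M : ℝ) / q - 1 ≤ (J M : ℝ) := by
      have hdm := Nat.div_add_mod (F M) q
      have hmod : F M % q < q := Nat.mod_lt _ (by omega)
      have e : (F M : ℝ) = q * (J M : ℝ) + (F M % q : ℕ) := by
        simp only [hJ]
        exact_mod_cast hdm.symm
      have hm : ((F M % q : ℕ) : ℝ) < q := by exact_mod_cast hmod
      rw [sub_le_iff_le_add, div_le_iff₀ hqR, e]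
      nlinarith
    have e3 : (M : ℝ) / (4 * Real.sqrt (Real.log M)) / r =
        (M : ℝ) / (4 * Real.sqrt (Real.log M)) / ((max n 1 : ℕ) * ℓ') / q := by
      rw [hr, div_div, div_div, div_div]
    rw [e3]
    have h3 := div_le_div_of_nonneg_right (c := (q : ℝ)) h1 hqR.le
    rw [sub_div] at h3
    have h4 : (1 : ℝ) / q ≤ 1 := by
      rw [div_le_one hqR]
      exact_mod_cast hq
    linarith
  -- `J M ≤ M` for `M ≥ 2`
  have hJ_upper : ∀ M : ℕ, 2 ≤ M → (J M : ℝ) ≤ M := by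
    intro M hM
    have hM2 : (2 : ℝ) ≤ M := by exact_mod_cast hM
    have h1 : (J M : ℝ) ≤ (F M : ℝ) := by exact_mod_cast Nat.div_le_self _ _
    have h2 : (F M : ℝ) ≤ (M : ℝ) / (4 * Real.sqrt (Real.log M)) / ((max n 1 : ℕ) * ℓ') :=
      Nat.floor_le (by positivity)
    have hden : (1 : ℝ) ≤ (max n 1 : ℕ) * ℓ' := by
      have h1 : (1 : ℝ) ≤ (max n 1 : ℕ) := by exact_mod_cast le_max_right n 1
      have h2 : (1 : ℝ) ≤ ℓ' := by exact_mod_cast hℓ'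
      nlinarith
    have hlog : Real.log 2 ≤ Real.log M := Real.log_le_log two_pos hM2
    have hl2 : (1 / 2 : ℝ) < Real.log 2 := by linarith [Real.log_two_gt_d9]
    have hsq : 1 / 2 < Real.sqrt (Real.log M) := by
      have : Real.sqrt (1 / 4) = 1 / 2 := by
        rw [show (1 / 4 : ℝ) = (1 / 2) ^ 2 by norm_num, Real.sqrt_sq (by norm_num)]
      rw [← this]
      exact Real.sqrt_lt_sqrt (by norm_num) (by linarith)
    have h3 : (M : ℝ) / (4 * Real.sqrt (Real.log M)) / ((max n 1 : ℕ) * ℓ') ≤ M := by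
      rw [div_div, div_le_iff₀ (by positivity)]
      have : (1 : ℝ) ≤ 4 * Real.sqrt (Real.log M) * ((max n 1 : ℕ) * ℓ') := by nlinarith
      nlinarith
    linarith
  -- the two comparison sequences
  have hlogpos : ∀ᶠ M : ℕ in atTop, 1 < Real.log M := by
    filter_upwards [eventually_ge_atTop 3] with M hM
    have hM3 : (3 : ℝ) ≤ M := by exact_mod_cast hM
    have := Real.exp_one_lt_d9
    rw [Real.lt_log_iff_exp_lt (by linarith)]
    linarith
  have hlow_t : Tendsto (fun M : ℕ => 1 - Real.log (Real.log M ^ (1 / 2 : ℝ) * (8 * r)) / Real.log M) atTop (𝓝 (1 - 0)) :=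
    tendsto_const_nhds.sub
      (Literature.NumberTheory.LFunctions.TypeDesign.tendsto_log_logPow_mul_div_log (1 / 2) (by positivity))
  rw [sub_zero] at hlow_t
  have hup_t : Tendsto (fun M : ℕ => 1 / Real.log M + 1) atTop (𝓝 (0 + 1)) :=
    (tendsto_const_nhds.div_atTop (Real.tendsto_log_atTop.comp tendsto_natCast_atTop_atTop)).add tendsto_const_nhds
  rw [zero_add] at hup_t
  -- `Y_M ≥ 2r` eventually (so that `J M + 1 ≥ Y_M/(2r)`)
  have hY : ∀ᶠ M : ℕ in atTop, 2 * r ≤ (M : ℝ) / (4 * Real.sqrt (Real.log M)) := by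
    have ht : Tendsto (fun M : ℕ => (M : ℝ) / (4 * Real.sqrt (Real.log M))) atTop atTop := by
      -- `M/(4√log M) ≥ √M/4` since `log M ≤ M`
      refine tendsto_atTop_mono' atTop ?_
        ((tendsto_rpow_atTop (by norm_num : (0 : ℝ) < 1 / 2)).comp tendsto_natCast_atTop_atTop |>.atTop_div_const
          (by norm_num : (0 : ℝ) < 4))
      filter_upwards [eventually_ge_atTop 2] with M hM
      have hM0 : (0 : ℝ) < M := by exact_mod_cast (by omega : 0 < M)
      have hM2 : (2 : ℝ) ≤ M := by exact_mod_cast hM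
      simp only [Function.comp_apply]
      have hlogM : 0 < Real.log M := Real.log_pos (by linarith)
      have hsq : Real.sqrt (Real.log M) ≤ (M : ℝ) ^ (1 / 2 : ℝ) := by
        rw [Real.sqrt_eq_rpow]
        exact Real.rpow_le_rpow hlogM.le (Real.log_le_self hM0.le) (by norm_num)
      have hsq0 : 0 < Real.sqrt (Real.log M) := Real.sqrt_pos.2 hlogM
      rw [div_le_div_iff₀ (by norm_num) (by positivity)]
      have hMM : (M : ℝ) = (M : ℝ) ^ (1 / 2 : ℝ) * (M : ℝ) ^ (1 / 2 : ℝ) := by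
        rw [← Real.rpow_add hM0]; norm_num
      nlinarith [Real.rpow_pos_of_pos hM0 (1 / 2 : ℝ)]
    exact ht.eventually_ge_atTop _
  -- squeeze
  refine tendsto_of_tendsto_of_tendsto_of_le_of_le' hlow_t hup_t ?_ ?_
  · filter_upwards [hlogpos, hY] with M hlogM hYM
    have hlog0 : 0 < Real.log M := by linarith
    have hYpos : 0 < (M : ℝ) / (4 * Real.sqrt (Real.log M)) := by linarith
    have hsq0 : 0 < Real.sqrt (Real.log M) := Real.sqrt_pos.2 hlog0
    have hM0 : (0 : ℝ) < M := by
      have := mul_pos hYpos (by positivity : (0 : ℝ) < 4 * Real.sqrt (Real.log M))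
      rwa [div_mul_cancel₀ _ (by positivity)] at this
    -- `log M − log(8r√log M) = log(Y_M/(2r)) ≤ log(J M + 1) ≤ H(J M)`
    have key : Real.log M - Real.log (Real.log M ^ (1 / 2 : ℝ) * (8 * r)) ≤ ∑ j ∈ Finset.Icc 1 (J M), (1 : ℝ) / j := by
      have e1 : Real.log M - Real.log (Real.log M ^ (1 / 2 : ℝ) * (8 * r)) =
          Real.log ((M : ℝ) / (4 * Real.sqrt (Real.log M)) / (2 * r)) := by
        rw [div_div, Real.log_div hM0.ne' (by positivity), Real.sqrt_eq_rpow]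
        congr 1
        congr 1
        ring
      rw [e1]
      refine le_trans (Real.log_le_log (by positivity) ?_) (log_succ_le_harmonicR (J M))
      have h1 := hJ_lower M
      rw [div_le_iff₀ (by positivity)]
      have : (M : ℝ) / (4 * Real.sqrt (Real.log M)) / r * r = (M : ℝ) / (4 * Real.sqrt (Real.log M)) :=
        div_mul_cancel₀ _ hr0.ne'
      nlinarith
    have h2 := div_le_div_of_nonneg_right key hlog0.le
    rw [sub_div, div_self hlog0.ne'] at h2
    rw [hW]
    exact h2
  · filter_upwards [hlogpos, eventually_ge_atTop 2] with M hlogM hM2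
    have hlog0 : 0 < Real.log M := by linarith
    have key : ∑ j ∈ Finset.Icc 1 (J M), (1 : ℝ) / j ≤ 1 + Real.log M := by
      have hH : ∑ j ∈ Finset.Icc 1 (J M), (1 : ℝ) / j ≤ 1 + Real.log (J M) := by
        rw [sum_Icc_one_div_eq_harmonic]
        exact harmonic_le_one_add_log (J M)
      refine hH.trans ?_
      rcases Nat.eq_zero_or_pos (J M) with h0 | hpos
      · rw [h0]
        simp only [Nat.cast_zero, Real.log_zero, add_zero]
        linarith
      · have hJ1 : (0 : ℝ) < J M := by exact_mod_cast hpos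
        linarith [Real.log_le_log hJ1 (hJ_upper M hM2)]
    have h2 := div_le_div_of_nonneg_right key hlog0.le
    rw [add_div, div_self hlog0.ne', add_comm] at h2
    rw [hW, add_comm]
    exact h2

/-- **Anchor `combTypeHarmonicWeightOne`** (registered sub-goal; `tendsto_harmWeight_div_log` with explicit quantifiers): the harmonic
cut-off weights, normalised by `log M`, tend to `1`. [folklore] -/
theorem combTypeHarmonicWeightOne : ∀ q ℓ' : ℕ, 1 ≤ q → 1 ≤ ℓ' → ∀ n : ℕ,
    Filter.Tendsto (fun M : ℕ => (∑ j ∈ Finset.Icc 1 (⌊(M : ℝ) / (4 * Real.sqrt (Real.log M)) / ((max n 1 : ℕ) * ℓ')⌋₊ / q),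
      (1 : ℝ) / j) / Real.log M) Filter.atTop (nhds 1) :=
  fun _ _ hq hℓ' n => tendsto_harmWeight_div_log hq hℓ' n

end CombType

end Summit.RiemannHypothesis.RiemannHypothesis.Theorems.SignConeConeMagnification

end
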